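import Summits.ABC.IUTFork.Cor312HullGluedDHVolScaled
import Summits.ABC.IUTFork.Cor312HullStableDHVolArchIndex
import HarnessLib

/-!
# [IUTchIII] Cor. 3.12 — the hull-gluing bracket at the SHARP setting of record MODULO THE PACKETS OVER `2·disc(F)`:
# `−|log(Θ)|`, the typed Statement and its `C_Θ`-form are unchanged once `hst` holds at those finitely many packets

PROOF-ONLY composition piece of the abc-iut cell (Cor. 3.12 sub-crew, seat abc-iut-c312-5, gen 4); TAKES NO SIDE on
[IUTchIII] Cor. 3.12; no definition, no `Prop` fact. abc-iut-w5-d060's `Cor312HullGluedStable` (p424693,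
`hullGlued_invariants_ofComparison_of_stable`) turns ONE-SET STABILITY `hst` of print's `^{n,∘}𝒰_{j,v_ℚ}` (kurims
`paper:url-4b091feeb646` p. 174 l. 50 – p. 175 l. 1) at EVERY label packet `(i+1, v_ℚ)` plus surjective comparisons into
the global invariants of the hull-gluing `P♮`. At c312-5's sharp setting of record (`Real.settingDHVolSharp`, abc-iut-c312-3
p419746; ARBITRARY non-zero Θ-ideles) `hst` is now a THEOREM at every archimedean packet (`Cor312HullStableDHVolArchIndex`)
and at every packet over an odd prime `p ∤ disc(F)` (`Cor312HullStableDHVol`); so: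

* `stable_thetaHull_settingDHVolSharp_of_not_dvd` — `hst` at `(i+1, v_ℚ)` for every `v_ℚ` not a prime dividing
  `2·|disc(F)|`;
* **`hullGlued_invariants_settingDHVolSharp_of_bad`** — IF `hst` holds at the (finitely many) packets `(i+1, p)` with
  `p ∣ 2·|disc(F)|`, THEN `−|log(Θ)|(P♮) = −|log(Θ)|(P)`, `P♮.Statement ↔ P.Statement`, `P♮.CThetaForm ↔ P.CThetaForm`
  (comparisons onto: abc-iut-c312-5 `factorMapDH_inr_surjective`, empty index at `∞`);
* `hullGlued_summary_settingDHVolSharp_of_bad` — with `BridgeHyps` in addition: `BridgeHyps`/`ThetaRegionsAdm`/`hθ` for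
  `P♮` as well (p424693 `hullGlued_summary_ofComparison_of_stable`).
This is the EXACT residual of the hull-gluing bracket at the setting ADJUDICATION-SPEC §1 names: a finite, explicit list
of packet hypotheses over `2·disc(F)` — where the seat's finding (typed (Ind2) moves hull-sets at ramified places,
`Cor312Ind2BallsRamified`; hull inflation by `p⁻¹` with unit boxes, hand computation on HOME/STATUS) says they can FAIL.
[claim: Mochizuki2012, status: disputed] vocabulary only; [cite: DupuyHilado2025, §3.9, §4.7, §4.9].
-/

noncomputable section

open Set Function NumberField IsDedekindDomain

namespace Summit.ABC

namespace IUTFork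

namespace Thm311

namespace Real

open Cor312 Cor312Vol Literature.IUT.LogThetaLattice Literature.IUT.LogVolume

variable {F : Type} [Field F] [NumberField F] (X : PilotData F) {logv : PadicLogs F} (hlog : LogvAnalytic logv)

variable (t : ∀ (pp : Nat.Primes) (_ : Fin X.lstar) (x : (thetaIndex X).Fibre (.inr pp)),
    haveI : Fact (pp : ℕ).Prime := ⟨pp.2⟩; kOf X pp.1 x)
  (tq : ∀ (pp : Nat.Primes) (x : (thetaIndex X).Fibre (.inr pp)),
    haveI : Fact (pp : ℕ).Prime := ⟨pp.2⟩; kOf X pp.1 x)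
  (M : Type) [Field M] [NumberField M]
  (archPk : ∀ (j : (thetaIndex X).Label) (vQ : (thetaIndex X).VQ), Set ((logShellsDH X logv).Packet j vQ))
  (archSub : ∀ (j : (thetaIndex X).Label) (v : (thetaIndex X).V),
    Set ((logShellsDH X logv).Packet j ((thetaIndex X).over v)))
  (Ψ : ℤ → ∀ v : (thetaIndex X).V, v ∈ (thetaIndex X).Vbad → Set ((logShellsDH X logv).StarPacket v))
  (act : ℤ → ∀ v : (thetaIndex X).V, v ∈ (thetaIndex X).Vbad →
    (logShellsDH X logv).StarPacket v → Module.End ℚ ((logShellsDH X logv).StarPacket v))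
  (Mmod : ℤ → ∀ j : (thetaIndex X).LabelStar, Set ((logShellsDH X logv).GlobalPacket j.1))
  (region : ℤ → ∀ j : (thetaIndex X).LabelStar, FinDivisor M → ∀ vQ : (thetaIndex X).VQ,
    Set ((logShellsDH X logv).Packet j.1 vQ))
  (n : ℤ) {HT : Type} {LogLink : HT → HT → Type} {IsFull : ∀ {s t : HT}, LogLink s t → Prop}
  (lat : LGPGaussianLogThetaLattice LogLink IsFull)
  {Frd : Type} {IsoF : Frd → Frd → Type} {Ob : Frd → Type} {realify : Frd → Frd} {Strip : Type}
  {IsoS : Strip → Strip → Type} {Mv : ∀ v : (thetaIndex X).V, v ∈ (thetaIndex X).Vbad → Type}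
  [∀ v h, Monoid (Mv v h)]
  (sig : GlobalLGPFrobenioidSignature (thetaIndex X).lstar (thetaIndex X).V (· ∈ (thetaIndex X).Vbad)
    Frd IsoF Ob realify Strip IsoS Mv)
  (split : SplittingMonoids Mv) {ObΔ : Type} {N : ∀ v : (thetaIndex X).V, v ∈ (thetaIndex X).Vbad → Type}
  [∀ v h, Monoid (N v h)] (qData : QPilotData ObΔ N)

/-- **`hst` at every label packet of the sharp setting of record NOT over a prime dividing `2·|disc(F)|`** (archimedean:
`Cor312HullStableDHVolArchIndex`; odd unramified prime: `Cor312HullStableDHVol`), arbitrary non-zero Θ-ideles.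
[cite: DupuyHilado2025, §3.9, §4.7, §4.9] -/
theorem stable_thetaHull_settingDHVolSharp_of_not_dvd (ht0 : ∀ pp i x, t pp i x ≠ 0) (htq0 : ∀ pp x, tq pp x ≠ 0)
    (htq1 : ∀ (pp : Nat.Primes) (x : (thetaIndex X).Fibre (.inr pp)),
      haveI : Fact (pp : ℕ).Prime := ⟨pp.2⟩; placeOf X pp.1 x ∉ X.S → ‖tq pp x‖ = 1)
    (i : Fin (thetaIndex X).lstar) (vQ : (thetaIndex X).VQ)
    (hvQ : ∀ pp : Nat.Primes, vQ = .inr pp → ¬ (pp : ℕ) ∣ 2 * (NumberField.discr F).natAbs) :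
    ∀ Φ ∈ Setting.indGroup (situationDHVol X hlog M archPk archSub Ψ act Mmod region),
      Φ (Setting.labelSucc i) vQ ''
          (settingDHVolSharp X hlog M archPk archSub Ψ act Mmod region n lat sig split qData tq t htq0
            htq1).thetaHull (Setting.labelSucc i) vQ =
        (settingDHVolSharp X hlog M archPk archSub Ψ act Mmod region n lat sig split qData tq t htq0
          htq1).thetaHull (Setting.labelSucc i) vQ := by
  cases vQ with
  | inl u =>
    exact stable_thetaHull_settingDHVol_inl X hlog M archPk archSub Ψ act Mmod region n lat sig split qData _ _ _ _
      (Setting.labelSucc i) u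
  | inr pp =>
    obtain ⟨hp2, hdisc⟩ := good_of_not_dvd (F := F) pp (hvQ pp rfl)
    exact stable_thetaHull_settingDHVolSharp_of_unramified X hlog t tq M archPk archSub Ψ act Mmod region n lat sig
      split qData ht0 htq0 htq1 i pp hp2 hdisc

/-- The field-factor comparison of the setting of record is onto at every packet (c312-5 `factorMapDH_inr_surjective`;
empty index at `∞`). [folklore] -/
theorem factorMapDH_surjective' (j : (thetaIndex X).Label) (vQ : (thetaIndex X).VQ) :
    Function.Surjective (factorMapDH X hlog j vQ) := by
  cases vQ with
  | inl u =>
    haveI := isEmpty_factorIdxDH_inl X hlog u j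
    exact fun y => ⟨0, Subsingleton.elim _ _⟩
  | inr pp => exact factorMapDH_inr_surjective X hlog j pp

/-- **The hull-gluing bracket at the sharp setting of record, MODULO `hst` AT THE PACKETS OVER `2·disc(F)` ONLY**: if
`^{n,∘}𝒰_{i+1,p}` is (Ind1),(Ind2)-stable at the finitely many packets with `p ∣ 2·|disc(F)|`, then the hull-glued setting
has the SAME `−|log(Θ)|`, an EQUIVALENT typed Statement and an EQUIVALENT `C_Θ`-form (p424693
`hullGlued_invariants_ofComparison_of_stable`; every other packet by theorem). [claim: Mochizuki2012, status: disputed] -/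
theorem hullGlued_invariants_settingDHVolSharp_of_bad (ht0 : ∀ pp i x, t pp i x ≠ 0) (htq0 : ∀ pp x, tq pp x ≠ 0)
    (htq1 : ∀ (pp : Nat.Primes) (x : (thetaIndex X).Fibre (.inr pp)),
      haveI : Fact (pp : ℕ).Prime := ⟨pp.2⟩; placeOf X pp.1 x ∉ X.S → ‖tq pp x‖ = 1)
    (hbad : ∀ (i : Fin (thetaIndex X).lstar) (pp : Nat.Primes), (pp : ℕ) ∣ 2 * (NumberField.discr F).natAbs →
      ∀ Φ ∈ Setting.indGroup (situationDHVol X hlog M archPk archSub Ψ act Mmod region),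
        Φ (Setting.labelSucc i) (.inr pp) ''
            (settingDHVolSharp X hlog M archPk archSub Ψ act Mmod region n lat sig split qData tq t htq0
              htq1).thetaHull (Setting.labelSucc i) (.inr pp) =
          (settingDHVolSharp X hlog M archPk archSub Ψ act Mmod region n lat sig split qData tq t htq0
            htq1).thetaHull (Setting.labelSucc i) (.inr pp)) :
    (settingDHVolSharp X hlog M archPk archSub Ψ act Mmod region n lat sig split qData tq t htq0
          htq1).hullGlued.negLogTheta =
        (settingDHVolSharp X hlog M archPk archSub Ψ act Mmod region n lat sig split qData tq t htq0
          htq1).negLogTheta ∧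
      ((settingDHVolSharp X hlog M archPk archSub Ψ act Mmod region n lat sig split qData tq t htq0
            htq1).hullGlued.Statement ↔
        (settingDHVolSharp X hlog M archPk archSub Ψ act Mmod region n lat sig split qData tq t htq0
          htq1).Statement) ∧
      ((settingDHVolSharp X hlog M archPk archSub Ψ act Mmod region n lat sig split qData tq t htq0
            htq1).hullGlued.CThetaForm ↔
        (settingDHVolSharp X hlog M archPk archSub Ψ act Mmod region n lat sig split qData tq t htq0
          htq1).CThetaForm) := by
  have hst : ∀ (i : Fin (thetaIndex X).lstar) (vQ : (thetaIndex X).VQ),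
      ∀ Φ ∈ Setting.indGroup (situationDHVol X hlog M archPk archSub Ψ act Mmod region),
        Φ (Setting.labelSucc i) vQ ''
            (settingDHVolSharp X hlog M archPk archSub Ψ act Mmod region n lat sig split qData tq t htq0
              htq1).thetaHull (Setting.labelSucc i) vQ =
          (settingDHVolSharp X hlog M archPk archSub Ψ act Mmod region n lat sig split qData tq t htq0
            htq1).thetaHull (Setting.labelSucc i) vQ := by
    intro i vQ
    by_cases h : ∀ pp : Nat.Primes, vQ = .inr pp → ¬ (pp : ℕ) ∣ 2 * (NumberField.discr F).natAbs
    · exact stable_thetaHull_settingDHVolSharp_of_not_dvd X hlog t tq M archPk archSub Ψ act Mmod region n lat sig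
        split qData ht0 htq0 htq1 i vQ h
    · push Not at h
      obtain ⟨pp, rfl, hpp⟩ := h
      exact hbad i pp hpp
  exact Setting.hullGlued_invariants_ofComparison_of_stable n lat sig split qData
    (realPiecesDH X hlog M archPk archSub Ψ act Mmod region (fun _ _ => thetaBoxDH X hlog (sharpBoxDH X hlog t))
      (fun _ => qCentreDH X hlog tq))
    (qCentreDH_ne_zero X hlog tq htq0) (hadm_DH X hlog M archPk archSub Ψ act Mmod region n)
    (finite_support_logvol_qRegion X hlog M archPk archSub Ψ act Mmod region n tq htq0 htq1)
    (fun i vQ => factorMapDH_surjective' X hlog (Setting.labelSucc i) vQ) hst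

/-- … and with `BridgeHyps`: the hull-glued sharp setting then also satisfies `BridgeHyps`, `ThetaRegionsAdm` and `hθ`
at every label packet (p424693 `hullGlued_summary_ofComparison_of_stable`). [claim: Mochizuki2012, status: disputed] -/
theorem hullGlued_summary_settingDHVolSharp_of_bad (ht0 : ∀ pp i x, t pp i x ≠ 0) (htq0 : ∀ pp x, tq pp x ≠ 0)
    (htq1 : ∀ (pp : Nat.Primes) (x : (thetaIndex X).Fibre (.inr pp)),
      haveI : Fact (pp : ℕ).Prime := ⟨pp.2⟩; placeOf X pp.1 x ∉ X.S → ‖tq pp x‖ = 1)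
    (hbad : ∀ (i : Fin (thetaIndex X).lstar) (pp : Nat.Primes), (pp : ℕ) ∣ 2 * (NumberField.discr F).natAbs →
      ∀ Φ ∈ Setting.indGroup (situationDHVol X hlog M archPk archSub Ψ act Mmod region),
        Φ (Setting.labelSucc i) (.inr pp) ''
            (settingDHVolSharp X hlog M archPk archSub Ψ act Mmod region n lat sig split qData tq t htq0
              htq1).thetaHull (Setting.labelSucc i) (.inr pp) =
          (settingDHVolSharp X hlog M archPk archSub Ψ act Mmod region n lat sig split qData tq t htq0
            htq1).thetaHull (Setting.labelSucc i) (.inr pp))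
    (H : BridgeHyps (settingDHVolSharp X hlog M archPk archSub Ψ act Mmod region n lat sig split qData tq t htq0 htq1)) :
    BridgeHyps (settingDHVolSharp X hlog M archPk archSub Ψ act Mmod region n lat sig split qData tq t htq0
        htq1).hullGlued ∧
      ThetaRegionsAdm (settingDHVolSharp X hlog M archPk archSub Ψ act Mmod region n lat sig split qData tq t htq0
        htq1).hullGlued ∧
      (∀ (i : Fin (thetaIndex X).lstar) (vQ : (thetaIndex X).VQ),
        ((situationDHVol X hlog M archPk archSub Ψ act Mmod region).D n).Adm _ vQ
          ((settingDHVolSharp X hlog M archPk archSub Ψ act Mmod region n lat sig split qData tq t htq0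
            htq1).hullGlued.thetaRegion3 (Setting.labelSucc i) vQ)) ∧
      (settingDHVolSharp X hlog M archPk archSub Ψ act Mmod region n lat sig split qData tq t htq0
          htq1).hullGlued.negLogTheta =
        (settingDHVolSharp X hlog M archPk archSub Ψ act Mmod region n lat sig split qData tq t htq0
          htq1).negLogTheta ∧
      ((settingDHVolSharp X hlog M archPk archSub Ψ act Mmod region n lat sig split qData tq t htq0
            htq1).hullGlued.Statement ↔
        (settingDHVolSharp X hlog M archPk archSub Ψ act Mmod region n lat sig split qData tq t htq0
          htq1).Statement) ∧
      ((settingDHVolSharp X hlog M archPk archSub Ψ act Mmod region n lat sig split qData tq t htq0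
            htq1).hullGlued.CThetaForm ↔
        (settingDHVolSharp X hlog M archPk archSub Ψ act Mmod region n lat sig split qData tq t htq0
          htq1).CThetaForm) := by
  have hst : ∀ (i : Fin (thetaIndex X).lstar) (vQ : (thetaIndex X).VQ),
      ∀ Φ ∈ Setting.indGroup (situationDHVol X hlog M archPk archSub Ψ act Mmod region),
        Φ (Setting.labelSucc i) vQ ''
            (settingDHVolSharp X hlog M archPk archSub Ψ act Mmod region n lat sig split qData tq t htq0
              htq1).thetaHull (Setting.labelSucc i) vQ =
          (settingDHVolSharp X hlog M archPk archSub Ψ act Mmod region n lat sig split qData tq t htq0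
            htq1).thetaHull (Setting.labelSucc i) vQ := by
    intro i vQ
    by_cases h : ∀ pp : Nat.Primes, vQ = .inr pp → ¬ (pp : ℕ) ∣ 2 * (NumberField.discr F).natAbs
    · exact stable_thetaHull_settingDHVolSharp_of_not_dvd X hlog t tq M archPk archSub Ψ act Mmod region n lat sig
        split qData ht0 htq0 htq1 i vQ h
    · push Not at h
      obtain ⟨pp, rfl, hpp⟩ := h
      exact hbad i pp hpp
  exact Cor312Vol.hullGlued_summary_ofComparison_of_stable n lat sig split qData
    (realPiecesDH X hlog M archPk archSub Ψ act Mmod region (fun _ _ => thetaBoxDH X hlog (sharpBoxDH X hlog t))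
      (fun _ => qCentreDH X hlog tq))
    (qCentreDH_ne_zero X hlog tq htq0) (hadm_DH X hlog M archPk archSub Ψ act Mmod region n)
    (finite_support_logvol_qRegion X hlog M archPk archSub Ψ act Mmod region n tq htq0 htq1)
    (fun i vQ => factorMapDH_surjective' X hlog (Setting.labelSucc i) vQ) hst H

end Real

end Thm311

end IUTFork

end Summit.ABC

end
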